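import Literature.MathematicalPhysics.KineticTheory.LangevinChainConfined

/-!
# The damped / anti-damped splitting schemes of the chain and the map between them (K3 vocabulary)

Definitions file for stub `stub_antiDampedGirsanov` (K3) of line `lebesgue-flip-duality`, crux ★
`BondHeatUncertainty.LinearResponseFTUR` (stmt-AtomisticToContinuum-9122). The anti-damped Girsanov
formula is proved through TIME DISCRETISATION: on the uniform grid `s_k = k h` both the damped chain
(friction `-γ p_b` at the bath sites `b ∈ {0, N-1}`) and the anti-damped chain (friction `+γ p_b`, driven
by the sign-flipped noise) are approximated by the SAME device — the FRICTIONLESS flow `Y₀` (Hamiltonian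
vector field, `drivenFlow` of `ConfinedForcedFlow.lean`) driven, on each step, by a linear RAMP whose
total impulse is `ε·(c_L x_L e_0 + c_R x_R e_{N-1}) - σγh·Π_R(z_k)`: the (signed) Brownian increment of
the step plus the friction impulse FROZEN at the state `z_k` at the beginning of the step and CLAMPED at
level `R` (`Π_R(z) = clamp_R(p_0) e_0 + clamp_R(p_{N-1}) e_{N-1}`; the clamp keeps the forcing bounded
uniformly in the mesh and is invisible on paths whose bath momenta stay below `R`). Signs:
`(ε, σ) = (1, 1)` is the damped scheme, `(ε, σ) = (-1, -1)` the anti-damped scheme driven by `-x`.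

* `clampR`, `leftMom`, `rightMom`, `frictionImpulse`, `noiseImpulse`, `SchemeData` (plain data: the
  frictionless drift `Y₀`, `γ`, the step `h`, the clamp level `R`, the noise amplitudes `c_L, c_R`),
  `SchemeData.impulse`, `ramp`, `SchemeData.state` (the states `z_k`, by recursion on `k`),
  `stepFrac`, `SchemeData.forcing` (the piecewise-linear momentum forcing built from the impulses),
  `SchemeData.path` (the scheme path = the frictionless flow driven by that forcing);
* `SchemeData.shift` — **the map between the two schemes**: `(S x)_k = -x_k + 2γh (clamp_R(p_0(z^a_k))/c_L,
  clamp_R(p_{N-1}(z^a_k))/c_R)`, `z^a` the anti-damped states — a PREDICTABLE affine map with linear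
  part `-id` (`shift_predictable`), for which **`state (1,1) y (S x) = state (-1,-1) y x`**
  (`state_damped_shift`): the damped scheme driven by `S x` IS the anti-damped scheme driven by `x`;
  `SchemeData.unshift` — the same construction from the damped states, the two-sided inverse of `shift`
  (`unshift_shift`, `shift_unshift`).

Everything here is algebra / recursion; the analysis (measurability, convergence of the schemes,
limits of the density ratio, the Fatou sandwich) is in the sequel files.
-/

noncomputable section

namespace Summit.AtomisticToContinuum.FouriersLaw.Theorems.LinearResponseFTUR

open MeasureTheory Filter Set Function
open Literature.MathematicalPhysics.KineticTheory
open Literature.MathematicalPhysics.KineticTheory.HeatConduction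

variable {N : ℕ}

/-! ### Clamp, bath momenta, impulses -/

/-- The clamp to `[-R, R]`. -/
def clampR (R v : ℝ) : ℝ := max (-R) (min R v)

/-- The momentum of the left bath site (`0` if there is no site). -/
def leftMom (N : ℕ) (z : PhaseSpace N) : ℝ := if h : 0 < N then z.2 ⟨0, h⟩ else 0

/-- The momentum of the right bath site `N - 1` (`0` if there is no site). -/
def rightMom (N : ℕ) (z : PhaseSpace N) : ℝ := if h : 0 < N then z.2 ⟨N - 1, by omega⟩ else 0

/-- The clamped friction direction `Π_R(z) = clamp_R(p_0) e_0 + clamp_R(p_{N-1}) e_{N-1}` (a momentum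
vector; for `N = 1` both terms sit on the single site, as in `OscillatorChain.generator`). -/
def frictionImpulse (N : ℕ) (R : ℝ) (z : PhaseSpace N) : PhaseSpace N :=
  bathVec N 0 (clampR R (leftMom N z)) + bathVec N (N - 1) (clampR R (rightMom N z))

/-- The noise impulse of a step with Brownian increments `x = (x_L, x_R)`: `c_L x_L e_0 + c_R x_R e_{N-1}`. -/
def noiseImpulse (N : ℕ) (cL cR : ℝ) (x : ℝ × ℝ) : PhaseSpace N :=
  bathVec N 0 (cL * x.1) + bathVec N (N - 1) (cR * x.2)

/-- The data of a splitting scheme: the frictionless drift `Y₀`, the friction constant `γ`, the time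
step `h`, the clamp level `R`, and the two noise amplitudes `c_L, c_R` (`= √(2γT_L), √(2γT_R)`).
Plain data, no axioms. -/
structure SchemeData (N : ℕ) where
  /-- the frictionless drift (Hamiltonian vector field) -/
  Y₀ : PhaseSpace N → PhaseSpace N
  /-- the friction constant -/
  γ : ℝ
  /-- the time step -/
  h : ℝ
  /-- the clamp level -/
  R : ℝ
  /-- the left noise amplitude -/
  cL : ℝ
  /-- the right noise amplitude -/
  cR : ℝ

/-- The linear ramp on `[0, h]` with total impulse `u`: `s ↦ (clamp(s, 0, h)/h) • u`. -/
def ramp (h : ℝ) (u : PhaseSpace N) (s : ℝ) : PhaseSpace N := (min (max s 0) h / h) • u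

/-- The elapsed fraction (in time units) of step `j` at time `s`: `min(max(s - jh, 0), h)` — `0` before the
step, `s - jh` during it, `h` after it; continuous in `s`. -/
def stepFrac (h : ℝ) (j : ℕ) (s : ℝ) : ℝ := min (max (s - j * h) 0) h

namespace SchemeData

variable (D : SchemeData N)

/-- The total impulse of a step with signs `(ε, σ)`, state `z` at the beginning of the step and
increments `x`: `ε·(noise impulse) - σγh·Π_R(z)`. -/
def impulse (ε σ : ℝ) (z : PhaseSpace N) (x : ℝ × ℝ) : PhaseSpace N :=
  ε • noiseImpulse N D.cL D.cR x - (σ * D.γ * D.h) • frictionImpulse N D.R z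

/-- **The scheme states** `z_k`: `z_0 = y`, `z_{k+1}` = the frictionless flow from `z_k` driven for time
`h` by the ramp of the impulse of step `k`. -/
def state (ε σ : ℝ) (y : PhaseSpace N) (x : ℕ → ℝ × ℝ) : ℕ → PhaseSpace N
  | 0 => y
  | k + 1 => drivenFlow D.Y₀ (state ε σ y x k) (ramp D.h (D.impulse ε σ (state ε σ y x k) (x k))) D.h

/-- **The scheme forcing** with `M` steps: the piecewise-linear momentum path
`F(s) = Σ_{j<M} (stepFrac_j(s)/h) • u_j`, `u_j` the impulse of step `j` (so `F(s_k) = Σ_{j<k} u_j` and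
`F` ramps linearly inside each step; constant after time `M h`). -/
def forcing (ε σ : ℝ) (M : ℕ) (y : PhaseSpace N) (x : ℕ → ℝ × ℝ) (s : ℝ) : PhaseSpace N :=
  ∑ j ∈ Finset.range M, (stepFrac D.h j s / D.h) • D.impulse ε σ (D.state ε σ y x j) (x j)

/-- **The scheme path** with `M` steps: the frictionless flow from `y` driven by the scheme forcing
(it passes through the states, `path (k h) = z_k` for `k ≤ M`, and inside step `k` it is the
frictionless flow from `z_k` under the ramp of the step: `…SchemePath.lean`). -/
def path (ε σ : ℝ) (M : ℕ) (y : PhaseSpace N) (x : ℕ → ℝ × ℝ) : ℝ → PhaseSpace N :=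
  drivenFlow D.Y₀ y (D.forcing ε σ M y x)

/-- **The map from the anti-damped to the damped increments**:
`(S x)_k = -x_k + 2γh·(clamp_R(p_0(z^a_k))/c_L, clamp_R(p_{N-1}(z^a_k))/c_R)`, `z^a` the anti-damped states
driven by `x`. -/
def shift (y : PhaseSpace N) (x : ℕ → ℝ × ℝ) (k : ℕ) : ℝ × ℝ :=
  (-(x k).1 + 2 * D.γ * D.h * clampR D.R (leftMom N (D.state (-1) (-1) y x k)) / D.cL,
    -(x k).2 + 2 * D.γ * D.h * clampR D.R (rightMom N (D.state (-1) (-1) y x k)) / D.cR)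

/-- The inverse construction, from the damped states driven by `x`. -/
def unshift (y : PhaseSpace N) (x : ℕ → ℝ × ℝ) (k : ℕ) : ℝ × ℝ :=
  (-(x k).1 + 2 * D.γ * D.h * clampR D.R (leftMom N (D.state 1 1 y x k)) / D.cL,
    -(x k).2 + 2 * D.γ * D.h * clampR D.R (rightMom N (D.state 1 1 y x k)) / D.cR)

/-- The initial state is `y`. -/
@[simp] theorem state_zero (ε σ : ℝ) (y : PhaseSpace N) (x : ℕ → ℝ × ℝ) : D.state ε σ y x 0 = y := rfl

/-- The recursion step of the scheme states. -/
theorem state_succ (ε σ : ℝ) (y : PhaseSpace N) (x : ℕ → ℝ × ℝ) (k : ℕ) :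
    D.state ε σ y x (k + 1) =
      drivenFlow D.Y₀ (D.state ε σ y x k) (ramp D.h (D.impulse ε σ (D.state ε σ y x k) (x k))) D.h := rfl

/-! ### Locality in the increments (predictability) -/

/-- The state `z_k` only depends on the increments `x_j`, `j < k`. -/
theorem state_congr (ε σ : ℝ) (y : PhaseSpace N) {x x' : ℕ → ℝ × ℝ} :
    ∀ k : ℕ, (∀ j, j < k → x j = x' j) → D.state ε σ y x k = D.state ε σ y x' k := by
  intro k
  induction k with
  | zero => intro _; rfl
  | succ k ih =>
    intro hk
    rw [state_succ, state_succ, ih (fun j hj => hk j (Nat.lt_succ_of_lt hj)), hk k (Nat.lt_succ_self k)]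

/-- `shift` is predictable: `(S x)_k + x_k` only depends on `x_j`, `j < k`. -/
theorem shift_predictable (y : PhaseSpace N) {x x' : ℕ → ℝ × ℝ} (k : ℕ) (hk : ∀ j, j < k → x j = x' j) :
    D.shift y x k + x k = D.shift y x' k + x' k := by
  simp only [shift, D.state_congr (-1) (-1) y k hk]
  ext <;> simp only [Prod.fst_add, Prod.snd_add] <;> ring

/-- `unshift` is predictable. -/
theorem unshift_predictable (y : PhaseSpace N) {x x' : ℕ → ℝ × ℝ} (k : ℕ) (hk : ∀ j, j < k → x j = x' j) :
    D.unshift y x k + x k = D.unshift y x' k + x' k := by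
  simp only [unshift, D.state_congr 1 1 y k hk]
  ext <;> simp only [Prod.fst_add, Prod.snd_add] <;> ring

/-! ### The two schemes are conjugate under the shift -/

/-- The clamped friction direction through its two components. -/
theorem frictionImpulse_eq (R : ℝ) (z : PhaseSpace N) :
    frictionImpulse N R z =
      bathVec N 0 (clampR R (leftMom N z)) + bathVec N (N - 1) (clampR R (rightMom N z)) := rfl

/-- `bathVec` is additive in the amplitude. -/
theorem bathVec_add (N k : ℕ) (a b : ℝ) : bathVec N k (a + b) = bathVec N k a + bathVec N k b := by
  ext i
  · simp [bathVec]
  · simp only [bathVec, Prod.snd_add, Pi.add_apply]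
    split_ifs <;> ring

/-- `bathVec` is homogeneous in the amplitude. -/
theorem smul_bathVec (N k : ℕ) (r a : ℝ) : r • bathVec N k a = bathVec N k (r * a) := by
  ext i
  · simp [bathVec]
  · simp only [bathVec, Prod.smul_snd, Pi.smul_apply, smul_eq_mul]
    split_ifs <;> ring

/-- **The key algebraic identity**: the damped impulse at the shifted increment equals the anti-damped
impulse, state for state (`c_L, c_R ≠ 0`). -/
theorem impulse_damped_shift (hL : D.cL ≠ 0) (hR : D.cR ≠ 0) (z : PhaseSpace N) (x : ℝ × ℝ) :
    D.impulse 1 1 z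
        (-x.1 + 2 * D.γ * D.h * clampR D.R (leftMom N z) / D.cL,
          -x.2 + 2 * D.γ * D.h * clampR D.R (rightMom N z) / D.cR) =
      D.impulse (-1) (-1) z x := by
  simp only [impulse, noiseImpulse, frictionImpulse_eq, one_smul, neg_smul, smul_add, smul_bathVec]
  have h1 : D.cL * (-x.1 + 2 * D.γ * D.h * clampR D.R (leftMom N z) / D.cL) =
      -(D.cL * x.1) + 2 * D.γ * D.h * clampR D.R (leftMom N z) := by field_simp
  have h2 : D.cR * (-x.2 + 2 * D.γ * D.h * clampR D.R (rightMom N z) / D.cR) =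
      -(D.cR * x.2) + 2 * D.γ * D.h * clampR D.R (rightMom N z) := by field_simp
  rw [h1, h2]
  ext i
  · simp [bathVec]
  · simp only [bathVec, Prod.snd_add, Prod.snd_sub, Prod.snd_neg, Pi.add_apply, Pi.sub_apply,
      Pi.neg_apply]
    split_ifs <;> ring

/-- **The damped scheme driven by the shifted increments is the anti-damped scheme**:
`state (1,1) y (S x) = state (-1,-1) y x`. -/
theorem state_damped_shift (hL : D.cL ≠ 0) (hR : D.cR ≠ 0) (y : PhaseSpace N) (x : ℕ → ℝ × ℝ) :
    ∀ k : ℕ, D.state 1 1 y (D.shift y x) k = D.state (-1) (-1) y x k := by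
  intro k
  induction k with
  | zero => rfl
  | succ k ih =>
    rw [state_succ, state_succ, ih]
    congr 2
    exact D.impulse_damped_shift hL hR _ (x k)

/-- Symmetrically, the anti-damped scheme driven by the unshifted increments is the damped scheme. -/
theorem state_anti_unshift (hL : D.cL ≠ 0) (hR : D.cR ≠ 0) (y : PhaseSpace N) (x : ℕ → ℝ × ℝ) :
    ∀ k : ℕ, D.state (-1) (-1) y (D.unshift y x) k = D.state 1 1 y x k := by
  intro k
  induction k with
  | zero => rfl
  | succ k ih =>
    rw [state_succ, state_succ, ih]
    congr 2
    -- the anti-damped impulse at the unshifted increment is the damped impulse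
    have h := D.impulse_damped_shift hL hR (D.state 1 1 y x k)
      (D.unshift y x k)
    -- `shift` of `unshift` is the identity componentwise
    have e1 : -(D.unshift y x k).1 + 2 * D.γ * D.h * clampR D.R (leftMom N (D.state 1 1 y x k)) / D.cL =
        (x k).1 := by simp only [unshift]; ring
    have e2 : -(D.unshift y x k).2 + 2 * D.γ * D.h * clampR D.R (rightMom N (D.state 1 1 y x k)) / D.cR =
        (x k).2 := by simp only [unshift]; ring
    rw [e1, e2, Prod.mk.eta] at h
    exact h.symm

/-- `unshift ∘ shift = id`. -/
theorem unshift_shift (hL : D.cL ≠ 0) (hR : D.cR ≠ 0) (y : PhaseSpace N) (x : ℕ → ℝ × ℝ) :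
    D.unshift y (D.shift y x) = x := by
  funext k
  simp only [unshift, D.state_damped_shift hL hR y x k, shift]
  ext <;> ring

/-- `shift ∘ unshift = id`. -/
theorem shift_unshift (hL : D.cL ≠ 0) (hR : D.cR ≠ 0) (y : PhaseSpace N) (x : ℕ → ℝ × ℝ) :
    D.shift y (D.unshift y x) = x := by
  funext k
  simp only [shift, D.state_anti_unshift hL hR y x k, unshift]
  ext <;> ring

/-- The FORCING of the damped scheme driven by `S x` is the anti-damped forcing driven by `x`. -/
theorem forcing_damped_shift (hL : D.cL ≠ 0) (hR : D.cR ≠ 0) (M : ℕ) (y : PhaseSpace N)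
    (x : ℕ → ℝ × ℝ) : D.forcing 1 1 M y (D.shift y x) = D.forcing (-1) (-1) M y x := by
  funext s
  simp only [forcing, D.state_damped_shift hL hR]
  refine Finset.sum_congr rfl fun j _ => ?_
  congr 1
  exact D.impulse_damped_shift hL hR _ _

/-- The scheme PATH of the damped scheme driven by `S x` is the anti-damped path driven by `x`. -/
theorem path_damped_shift (hL : D.cL ≠ 0) (hR : D.cR ≠ 0) (M : ℕ) (y : PhaseSpace N)
    (x : ℕ → ℝ × ℝ) : D.path 1 1 M y (D.shift y x) = D.path (-1) (-1) M y x := by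
  simp only [path, D.forcing_damped_shift hL hR]

end SchemeData

/-! ### Elementary facts about the clamp and the ramp -/

/-- The clamp takes values in `[-R, R]` (`R ≥ 0`). -/
theorem clampR_le {R : ℝ} (hR : 0 ≤ R) (v : ℝ) : |clampR R v| ≤ R := by
  unfold clampR
  rw [abs_le]
  constructor
  · exact le_max_left _ _
  · exact max_le (by linarith) (min_le_left _ _)

/-- The clamp is the identity on `[-R, R]`. -/
theorem clampR_of_abs_le {R v : ℝ} (h : |v| ≤ R) : clampR R v = v := by
  unfold clampR
  rw [abs_le] at h
  rw [min_eq_right h.2, max_eq_right h.1]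

/-- The clamp is continuous. -/
theorem continuous_clampR (R : ℝ) : Continuous (clampR R) :=
  continuous_const.max (continuous_const.min continuous_id)

/-- The clamp is `1`-Lipschitz. -/
theorem lipschitz_clampR (R : ℝ) : LipschitzWith 1 (clampR R) :=
  (LipschitzWith.id.const_min R).const_max (-R)

/-- The ramp is clamped at its initial value on `(-∞, 0]`. -/
theorem ramp_of_nonpos (h : ℝ) (u : PhaseSpace N) {s : ℝ} (hs : s ≤ 0) : ramp h u s = ramp h u 0 := by
  unfold ramp
  rw [max_eq_right hs, max_self]

/-- The ramp starts at `0` (`h ≥ 0`). -/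
theorem ramp_zero {h : ℝ} (hh : 0 ≤ h) (u : PhaseSpace N) : ramp h u 0 = 0 := by
  unfold ramp
  rw [max_self, min_eq_left hh, zero_div, zero_smul]

/-- The ramp has reached its total impulse `u` at times `≥ h` (`h > 0`). -/
theorem ramp_of_le {h : ℝ} (hh : 0 < h) (u : PhaseSpace N) {s : ℝ} (hs : h ≤ s) : ramp h u s = u := by
  unfold ramp
  rw [min_eq_right (le_max_of_le_left hs), div_self hh.ne', one_smul]

/-- A ramp of a momentum vector is a momentum path. -/
theorem ramp_mem_momentumSubspace (h : ℝ) {u : PhaseSpace N} (hu : u ∈ momentumSubspace N) (s : ℝ) :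
    ramp h u s ∈ momentumSubspace N :=
  (momentumSubspace N).smul_mem _ hu

/-- The ramp is continuous in time. -/
theorem continuous_ramp (h : ℝ) (u : PhaseSpace N) : Continuous (ramp h u) := by
  unfold ramp
  exact (((continuous_id.max continuous_const).min continuous_const).div_const h).smul
    continuous_const

/-- The clamped friction direction is a momentum vector. -/
theorem frictionImpulse_mem (R : ℝ) (z : PhaseSpace N) : frictionImpulse N R z ∈ momentumSubspace N :=
  (momentumSubspace N).add_mem (bathVec_mem_momentumSubspace N _ _) (bathVec_mem_momentumSubspace N _ _)

/-- The noise impulse is a momentum vector. -/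
theorem noiseImpulse_mem (cL cR : ℝ) (x : ℝ × ℝ) : noiseImpulse N cL cR x ∈ momentumSubspace N :=
  (momentumSubspace N).add_mem (bathVec_mem_momentumSubspace N _ _) (bathVec_mem_momentumSubspace N _ _)

/-- The step impulse is a momentum vector. -/
theorem SchemeData.impulse_mem (D : SchemeData N) (ε σ : ℝ) (z : PhaseSpace N) (x : ℝ × ℝ) :
    D.impulse ε σ z x ∈ momentumSubspace N :=
  (momentumSubspace N).sub_mem ((momentumSubspace N).smul_mem _ (noiseImpulse_mem _ _ _))
    ((momentumSubspace N).smul_mem _ (frictionImpulse_mem _ _))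

/-- **Conjugacy of the two schemes** (registered sub-goal of the crux item, `∀`-form of
`SchemeData.state_damped_shift`): the damped scheme driven by the shifted increments is the anti-damped
scheme, state by state. -/
theorem scheme_state_damped_shift :
    ∀ (N : ℕ) (D : SchemeData N), D.cL ≠ 0 → D.cR ≠ 0 → ∀ (y : PhaseSpace N) (x : ℕ → ℝ × ℝ) (k : ℕ),
      D.state 1 1 y (D.shift y x) k = D.state (-1) (-1) y x k :=
  fun _ D hL hR y x k => D.state_damped_shift hL hR y x k

end Summit.AtomisticToContinuum.FouriersLaw.Theorems.LinearResponseFTUR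

end
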